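import Literature.AlgebraicGeometry.Modules.PushforwardIsoUnit
import Literature.AlgebraicGeometry.HodgeTheory.SemiregularityHigherSigma
import Literature.AlgebraicGeometry.HodgeTheory.HodgeSheafComapIso
import HarnessLib

/-!
# The twisted Homs `E ⊗ Ωʲ`, the twisted jet modules `Pʲ(E)` and the Atiyah steps along an isomorphism of
# `S`-schemes

Layer `Literature/AlgebraicGeometry/HodgeTheory`; companion of `SemiregularityHigherSigma.lean` (the
Buchweitz–Flenner components `σ_q = Tr(∗ · At(E)^q)` on real carriers: `twistHodge E j = 𝓗om(E^∨, Ωʲ)`,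
the twisted jet modules `twistJetModule E j = Pʲ(E)` with `a • (φ, ψ) = (aφ, aψ + da ∧ φ)`, their Yoneda
classes `atiyahClassStep`, `atiyahClassPower`, and `ι = toTwistHodgeZero`), which records verbatim
«Not here: … functoriality in `X` …». THIS FILE supplies that functoriality along an ISOMORPHISM
`e : X₀ ≅ X₁` of `S`-schemes (everything PROVED; no named fact, no new notion — only comparison
isomorphisms between existing objects and their compatibilities), for the push-forward `e_*`
(`Scheme.Modules.pushforward e.hom.left`, an equivalence of module categories):

* `twistHodgePushforwardIso e E j : e_*(E ⊗ Ωʲ_{X₀}) ≅ (e_*E) ⊗ Ωʲ_{X₁}` (from `PushforwardIsoUnit` and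
  `hodgeSheaf.comapIso`), with its sections formula;
* `wedgeSheafHom_comp_sheafHomMap_comap` — **the wedge commutes with pull-back of forms**,
  `g^♯(θ ∧ ω) = g^♯θ ∧ g^♯ω`, for ANY morphism `g` of `S`-schemes (checked on presheaf-level forms,
  `hodgeSheaf.hom_ext_toHodgeSheaf`); `wedge_evalAt_dSection_comap` — the twisting term `da ∧ –` along
  `g^♯` (`comap_app_dSection`);
* `twistJetPushforwardIso e E j : e_* Pʲ(E) ≅ Pʲ(e_* E)`, componentwise `(φ, ψ) ↦ (α_j φ, α_{j+1} ψ)`,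
  linear for the TWISTED structures (`twistHodgePushforwardIso_hom_app_wedgeD`), compatible with `ι`
  and `π` — a morphism of the twisted Atiyah sequences `twistJetShortComplexPushforwardHom`;
* **`mapExactFunctor_atiyahClassStep`**, **`mapExactFunctor_atiyahClassPower`** — `e_*(at_j(E)) =
  α_j · at_j(e_*E) · α_{j+1}⁻¹` and `e_*(At(E)^q) = α_0 · At(e_*E)^q · α_q⁻¹` in `Ext`
  (Mathlib's `extClass_naturality`, `mapExactFunctor_extClass`);
* `hodgeSheafZeroIso_inv_comp_comap` (pull-back of `0`-forms is `e♯`) and **`map_toTwistHodgeZero_comp`**: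
  `e_*(ι_E) ≫ α_0 = ι_{e_*E}`.

Motivation (venture HSemireg, bridge (B1), obligation (T-σ)): with the trace transport of
`Modules/PushforwardIsoContract.lean` these give the invariance of Buchweitz–Flenner `I`-semiregularity under
isomorphisms of the ambient scheme (`HodgeTheory/ISemiregularOfSchemeIso.lean`).

References: R.-O. Buchweitz, H. Flenner, *A semiregularity map for modules and applications to
deformations*, Compositio Math. 137 (2003), §3 (Atiyah class), §4 (the algebra `A`, `At^k`, trace)
[BuchweitzFlenner2003]; R. Hartshorne, *Algebraic Geometry* (1977), II Ex. 5.1, II Ex. 5.16 (e), II Prop.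
8.11 [Hartshorne1977]. The statements are bookkeeping along an isomorphism (reading; no printed statement
is typed verbatim).
-/

noncomputable section

-- `TopCat.Presheaf`/`Scheme.Modules` are not reducible (as in Mathlib's `AlgebraicGeometry/Modules/Sheaf.lean`).
set_option backward.isDefEq.respectTransparency false

open CategoryTheory CategoryTheory.Limits CategoryTheory.Abelian AlgebraicGeometry Opposite TopologicalSpace
open AlgebraicGeometry.Scheme.Modules

universe u w

namespace Literature.AlgebraicGeometry.HodgeTheory

open Literature.AlgebraicGeometry.Modules Literature.AlgebraicGeometry.Motives

variable {S : Type u} [CommRing S] {X₀ X₁ : Over (Spec (CommRingCat.of S))} (e : X₀ ≅ X₁)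

/-- The isomorphism of underlying schemes of an isomorphism of `S`-schemes. [folklore] -/
abbrev leftIso' : X₀.left ≅ X₁.left := ⟨e.hom.left, e.inv.left, by rw [← Over.comp_left, e.hom_inv_id]; rfl,
  by rw [← Over.comp_left, e.inv_hom_id]; rfl⟩

/-- `e_*` (on the underlying schemes) is an equivalence of module categories. [folklore] -/
instance isEquivalence_pushforward_left : (pushforward e.hom.left).IsEquivalence :=
  isEquivalence_pushforward_hom (leftIso' e)

/-! ### The twisted Homs `E ⊗ Ωʲ` along `e_*` -/

section Twist

variable (E : X₀.left.Modules) (j : ℕ)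

/-- **`e_* (E ⊗ Ωʲ_{X₀}) ≅ (e_* E) ⊗ Ωʲ_{X₁}`** in the model `𝓗om(E^∨, Ωʲ)`. [folklore] -/
def twistHodgePushforwardIso :
    (pushforward e.hom.left).obj (twistHodge E j) ≅ twistHodge ((pushforward e.hom.left).obj E) j :=
  sheafHomDualPushforwardIso (leftIso' e) E (hodgeSheaf X₀ j) ≪≫
    (sheafHomFunctor _).mapIso (hodgeSheaf.comapIso e j).symm

end Twist

/-! ### The wedge and the twisting term along a morphism of `S`-schemes -/

section WedgeComap

variable {X₀' X₁' : Over (Spec (CommRingCat.of S))} (g : X₀' ⟶ X₁') (j : ℕ)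

/-- **The wedge commutes with pull-back of forms**: `g^♯(θ ∧ ω) = g^♯θ ∧ g^♯ω`, as the identity
`∧_{X₁} ≫ 𝓗om(Ω¹, g^♯) = g^♯ ≫ g_*(∧_{X₀}) ≫ (g_*𝓗om ⟶ 𝓗om g_*) ≫ 𝓗om(g^♯, –)` of morphisms
`Ωʲ_{X₁} ⟶ 𝓗om(Ω¹_{X₁}, g_* Ωʲ⁺¹_{X₀})`.
[cite: Hartshorne1977, II Ex. 5.16 (e) with II Prop. 8.11 (pull-back of exterior powers of differentials is multiplicative)] -/
theorem wedgeSheafHom_comp_sheafHomMap_comap :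
    wedgeSheafHom X₁' j ≫ sheafHomMap (cotangentSheaf X₁') (hodgeSheaf.comap g (j + 1)) =
      hodgeSheaf.comap g j ≫ (pushforward g.left).map (wedgeSheafHom X₀' j) ≫
        sheafHomPushforwardComparison g.left (cotangentSheaf X₀') (hodgeSheaf X₀' (j + 1)) ≫
          sheafHomMapLeft (cotangentSheaf.comap g) _ := by
  refine hodgeSheaf.hom_ext_toHodgeSheaf j _ _ fun U ω => ?_
  change (sheafHomMap (cotangentSheaf X₁') (hodgeSheaf.comap g (j + 1))).app U
      ((wedgeSheafHom X₁' j).val.app (op U) ((toHodgeSheaf X₁' j).app (op U) ω)) =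
    (sheafHomMapLeft (cotangentSheaf.comap g) _).app U
      (pushforwardOverHom g.left _ _
        ((wedgeSheafHom X₀' j).val.app (op (g.left ⁻¹ᵁ U))
          ((hodgeSheaf.comap g j).app U ((toHodgeSheaf X₁' j).app (op U) ω))))
  rw [hodgeSheaf.comap_app_toHodgeSheaf, wedgeSheafHom_app_toHodgeSheaf, wedgeSheafHom_app_toHodgeSheaf,
    sheafHomMap_app_apply, sheafHomMapLeft_app_apply]
  refine hom_ext_of_appLE fun W k θ => ?_
  rw [appLE_comp_over_map, appLE_wedgeHom, appLE_over_map_comp, appLE_pushforwardOverHom, appLE_wedgeHom,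
    wedgeSection, wedgeSection, hodgeSheaf.comap_app_toHodgeSheaf, ← restrWedge_apply, ← restrWedge_apply,
    restrWedge_comapWedge]
  exact congrArg _ (exteriorPowerMap'_wedgeLeftHom (comapOneApp g W) j θ _)

/-- **The twisting term along `g^♯`, over an open `U`**: for `a ∈ Γ(X₁, U)`,
`(∧ then ev_{da} then g^♯) = (g^♯ then g_*∧ then ev_{d(g♯a)})` as morphisms
`Ωʲ_{X₁}|_U ⟶ (g_*Ωʲ⁺¹_{X₀})|_U`. [cite: Hartshorne1977, II Ex. 5.16 (e) with II Prop. 8.11 (pull-back of exterior powers of differentials; reading: the wedge is multiplicative under pull-back)] -/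
theorem wedge_evalAt_dSection_comap (U : X₁'.left.Opens) (a : Γ(X₁'.left, U)) :
    (SheafOfModules.overFunctor _ U).map (wedgeSheafHom X₁' j) ≫
        evalAt (M := hodgeSheaf X₁' (j + 1)) (dSection X₁' U a) ≫
          (SheafOfModules.overFunctor _ U).map (hodgeSheaf.comap g (j + 1)) =
      (SheafOfModules.overFunctor _ U).map (hodgeSheaf.comap g j) ≫
        (SheafOfModules.overFunctor _ U).map ((pushforward g.left).map (wedgeSheafHom X₀' j)) ≫
          pushforwardOverHom g.left _ _
            (evalAt (M := hodgeSheaf X₀' (j + 1)) (dSection X₀' (g.left ⁻¹ᵁ U) (g.left.app U a))) := by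
  refine hom_ext_of_appLE fun W k x => ?_
  have h := congrArg (fun φ : hodgeSheaf X₁' j ⟶
      sheafHom (cotangentSheaf X₁') ((pushforward g.left).obj (hodgeSheaf X₀' (j + 1))) =>
    appLE (show (cotangentSheaf X₁').over W ⟶ ((pushforward g.left).obj (hodgeSheaf X₀' (j + 1))).over W
      from Scheme.Modules.Hom.app φ W x) (𝟙 W)
    (dSection X₁' W (X₁'.left.presheaf.map k.op a))) (wedgeSheafHom_comp_sheafHomMap_comap g j)
  simp only [Scheme.Modules.Hom.comp_app, ConcreteCategory.comp_apply, sheafHomMap_app_apply,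
    sheafHomMapLeft_app_apply, appLE_comp_over_map, appLE_over_map_comp, comap_app_dSection,
    sheafHomPushforwardComparison_app_apply, appLE_pushforwardOverHom] at h
  rw [appLE_comp, appLE_comp, appLE_over_map, appLE_over_map, appLE_evalAt, map_dSection, h, appLE_comp,
    appLE_comp, appLE_over_map, appLE_over_map, appLE_pushforwardOverHom, appLE_evalAt, map_dSection,
    appLE_congr_hom _ ((Opens.map g.left.base).map (𝟙 W)) (𝟙 _)]
  congr 2
  exact (ConcreteCategory.congr_hom (g.left.naturality k.op) a)

end WedgeComap

/-! ### The twisted jet module along `e_*` -/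

section TwistJetIso

variable (E : X₀.left.Modules) (j : ℕ)

/-- Sections of `α_j`: `φ ↦ (e_*E^∨ ≅ (e_*E)^∨)⁻¹| ≫ (φ pushed forward) ≫ (e^♯)⁻¹|`. [cite: Hartshorne1977, II Ex. 5.1 (a), (b) (E → E^∨∨, 𝓗om(E^∨, G) ≅ E ⊗ G; reading: bookkeeping along an isomorphism of schemes)] -/
theorem twistHodgePushforwardIso_hom_app (U : X₁.left.Opens)
    (φ : (dual E).over (e.hom.left ⁻¹ᵁ U) ⟶ (hodgeSheaf X₀ j).over (e.hom.left ⁻¹ᵁ U)) :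
    (twistHodgePushforwardIso e E j).hom.app U φ =
      (SheafOfModules.overFunctor _ U).map (dualPushforwardIso (leftIso' e) E).inv ≫
        pushforwardOverHom e.hom.left _ _ φ ≫
          (SheafOfModules.overFunctor _ U).map (hodgeSheaf.comapIso e j).inv := by
  change (sheafHomMap _ (hodgeSheaf.comapIso e j).inv).app U
    ((sheafHomMapLeft (dualPushforwardIso (leftIso' e) E).inv _).app U (pushforwardOverHom e.hom.left _ _ φ)) = _
  rw [sheafHomMapLeft_app_apply, sheafHomMap_app_apply, Category.assoc]

/-- **The twisting terms correspond under `α`**: `α_{j+1}(D_{X₀}(e♯a, φ)) = D_{X₁}(a, α_j φ)`. [cite: BuchweitzFlenner2003, §3 (Atiyah class) and §4 (the algebra A = ⊕ Ext^i(E, E ⊗ Ωʲ), At^k; reading: naturality under an isomorphism of the ambient scheme)] -/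
theorem twistHodgePushforwardIso_hom_app_wedgeD (U : X₁.left.Opens) (a : Γ(X₁.left, U))
    (φ : (dual E).over (e.hom.left ⁻¹ᵁ U) ⟶ (hodgeSheaf X₀ j).over (e.hom.left ⁻¹ᵁ U)) :
    (twistHodgePushforwardIso e E (j + 1)).hom.app U (wedgeD E j (e.hom.left ⁻¹ᵁ U) (e.hom.left.app U a) φ) =
      wedgeD ((pushforward e.hom.left).obj E) j U a ((twistHodgePushforwardIso e E j).hom.app U φ) := by
  rw [twistHodgePushforwardIso_hom_app, twistHodgePushforwardIso_hom_app, wedgeD, wedgeD,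
    pushforwardOverHom_comp', pushforwardOverHom_comp', pushforwardOverHom_overFunctor_map]
  simp only [Category.assoc]
  congr 2
  -- `g_*∧ ≫ ev_{d(e♯a)} ≫ (e^♯)⁻¹ = (e^♯_j)⁻¹ ≫ ∧ ≫ ev_{da}` on `(e_*Ωʲ_{X₀})|_U`
  have h := wedge_evalAt_dSection_comap e.hom j U a
  have hj : (SheafOfModules.overFunctor _ U).map (hodgeSheaf.comapIso e j).inv ≫
      (SheafOfModules.overFunctor _ U).map (hodgeSheaf.comap e.hom j) = 𝟙 _ := by
    rw [← Functor.map_comp, ← hodgeSheaf.comapIso_hom, Iso.inv_hom_id, CategoryTheory.Functor.map_id]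
  have hj1 : (SheafOfModules.overFunctor _ U).map (hodgeSheaf.comap e.hom (j + 1)) ≫
      (SheafOfModules.overFunctor _ U).map (hodgeSheaf.comapIso e (j + 1)).inv = 𝟙 _ := by
    rw [← Functor.map_comp, ← hodgeSheaf.comapIso_hom, Iso.hom_inv_id, CategoryTheory.Functor.map_id]
  have h' := congrArg (fun ψ => (SheafOfModules.overFunctor _ U).map (hodgeSheaf.comapIso e j).inv ≫ ψ ≫
    (SheafOfModules.overFunctor _ U).map (hodgeSheaf.comapIso e (j + 1)).inv) h
  simp only [Category.assoc] at h'
  rw [hj1, Category.comp_id, ← Category.assoc _ _ (_ ≫ _), hj, Category.id_comp] at h'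
  exact h'.symm

/-- The second components match under the twisted actions (linearity of `(φ, ψ) ↦ (α_j φ, α_{j+1} ψ)`).
[cite: BuchweitzFlenner2003, §3 (Atiyah class) and §4 (the algebra A = ⊕ Ext^i(E, E ⊗ Ωʲ), At^k; reading: naturality under an isomorphism of the ambient scheme)] -/
theorem twistHodgePushforwardIso_hom_app_snd_smul (U : X₁.left.Opens) (a : Γ(X₁.left, U))
    (p : TwistJetSections E j (e.hom.left ⁻¹ᵁ U)) :
    (twistHodgePushforwardIso e E (j + 1)).hom.app U ((e.hom.left.app U a • p).snd) =
      (a • (TwistJetSections.mk ((twistHodgePushforwardIso e E j).hom.app U p.fst)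
        ((twistHodgePushforwardIso e E (j + 1)).hom.app U p.snd) :
          TwistJetSections ((pushforward e.hom.left).obj E) j U)).snd := by
  have h2 : (twistHodgePushforwardIso e E (j + 1)).hom.app U (e.hom.left.app U a • p.snd) =
      a • (twistHodgePushforwardIso e E (j + 1)).hom.app U p.snd :=
    Scheme.Modules.Hom.app_smul (twistHodgePushforwardIso e E (j + 1)).hom a p.snd
  rw [TwistJetSections.snd_smul, TwistJetSections.snd_smul, TwistJetSections.fst_mk,
    TwistJetSections.snd_mk, map_add, twistHodgePushforwardIso_hom_app_wedgeD, h2]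

/-- The map `e_* Pʲ(E) ⟶ Pʲ(e_* E)` on sections: `(φ, ψ) ↦ (α_j φ, α_{j+1} ψ)`, `𝒪_{X₁}`-linear for the
twisted structures by `twistHodgePushforwardIso_hom_app_wedgeD`. [folklore] -/
def twistJetPushforwardHom :
    (pushforward e.hom.left).obj (twistJetModule E j) ⟶ twistJetModule ((pushforward e.hom.left).obj E) j where
  val := PresheafOfModules.homMk
    { app := fun U => AddCommGrpCat.ofHom
        { toFun := fun p : TwistJetSections E j (e.hom.left ⁻¹ᵁ U.unop) =>
            (TwistJetSections.mk ((twistHodgePushforwardIso e E j).hom.app U.unop p.fst)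
              ((twistHodgePushforwardIso e E (j + 1)).hom.app U.unop p.snd) :
                TwistJetSections ((pushforward e.hom.left).obj E) j U.unop)
          map_zero' := TwistJetSections.ext (map_zero _) (map_zero _)
          map_add' := fun p q => TwistJetSections.ext (map_add _ p.fst q.fst) (map_add _ p.snd q.snd) }
      naturality := fun {U _} i =>
        AddCommGrpCat.ext fun (p : TwistJetSections E j (e.hom.left ⁻¹ᵁ U.unop)) => TwistJetSections.ext
          (Scheme.Modules.Hom.app_map_apply (twistHodgePushforwardIso e E j).hom i.unop p.fst)
          (Scheme.Modules.Hom.app_map_apply (twistHodgePushforwardIso e E (j + 1)).hom i.unop p.snd) }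
    (fun U (a : Γ(X₁.left, U.unop)) (p : TwistJetSections E j (e.hom.left ⁻¹ᵁ U.unop)) => TwistJetSections.ext
      (Scheme.Modules.Hom.app_smul (twistHodgePushforwardIso e E j).hom a p.fst)
      (twistHodgePushforwardIso_hom_app_snd_smul e E j U.unop a p))

/-- Sections of `twistJetPushforwardHom`. [cite: BuchweitzFlenner2003, §3 (Atiyah class) and §4 (the algebra A = ⊕ Ext^i(E, E ⊗ Ωʲ), At^k; reading: naturality under an isomorphism of the ambient scheme)] -/
@[simp]
theorem twistJetPushforwardHom_app_apply (U : X₁.left.Opens) (p : TwistJetSections E j (e.hom.left ⁻¹ᵁ U)) :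
    (twistJetPushforwardHom e E j).app U p =
      (TwistJetSections.mk ((twistHodgePushforwardIso e E j).hom.app U p.fst)
        ((twistHodgePushforwardIso e E (j + 1)).hom.app U p.snd) :
          TwistJetSections ((pushforward e.hom.left).obj E) j U) := rfl

set_option maxHeartbeats 400000 in
/-- `e_* Pʲ(E) ⟶ Pʲ(e_* E)` is an isomorphism (componentwise the isomorphisms `α_j`, `α_{j+1}`). [folklore] -/
instance isIso_twistJetPushforwardHom : IsIso (twistJetPushforwardHom e E j) := by
  refine Scheme.Modules.Hom.isIso_iff_isIso_app.mpr fun U => ?_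
  rw [ConcreteCategory.isIso_iff_bijective]
  have h1 := ConcreteCategory.bijective_of_isIso ((twistHodgePushforwardIso e E j).hom.app U)
  have h2 := ConcreteCategory.bijective_of_isIso ((twistHodgePushforwardIso e E (j + 1)).hom.app U)
  refine ⟨fun p q hpq => TwistJetSections.ext (h1.1 (congrArg TwistJetSections.fst hpq))
    (h2.1 (congrArg TwistJetSections.snd hpq)), fun q => ?_⟩
  obtain ⟨φ, hφ⟩ := h1.2 (TwistJetSections.fst q)
  obtain ⟨ψ, hψ⟩ := h2.2 (TwistJetSections.snd q)
  exact ⟨TwistJetSections.mk φ ψ, TwistJetSections.ext hφ hψ⟩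

/-- **`e_* Pʲ(E) ≅ Pʲ(e_* E)`** — the twisted jet module along `e_*`. [folklore] -/
def twistJetPushforwardIso :
    (pushforward e.hom.left).obj (twistJetModule E j) ≅ twistJetModule ((pushforward e.hom.left).obj E) j :=
  asIso (twistJetPushforwardHom e E j)

/-- Compatibility of `e_* Pʲ(E) ≅ Pʲ(e_* E)` with the inclusions `E ⊗ Ωʲ⁺¹ → Pʲ`. [cite: BuchweitzFlenner2003, §3 (Atiyah class) and §4 (the algebra A = ⊕ Ext^i(E, E ⊗ Ωʲ), At^k; reading: naturality under an isomorphism of the ambient scheme)] -/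
theorem map_twistJetι_comp_twistJetPushforwardIso_hom :
    (pushforward e.hom.left).map (twistJetι E j) ≫ (twistJetPushforwardIso e E j).hom =
      (twistHodgePushforwardIso e E (j + 1)).hom ≫ twistJetι ((pushforward e.hom.left).obj E) j := by
  refine Scheme.Modules.hom_ext _ _ fun U => AddCommGrpCat.ext
    fun (ψ : (dual E).over (e.hom.left ⁻¹ᵁ U) ⟶ (hodgeSheaf X₀ (j + 1)).over (e.hom.left ⁻¹ᵁ U)) => ?_
  exact TwistJetSections.ext (map_zero ((twistHodgePushforwardIso e E j).hom.app U).hom) rfl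

/-- Compatibility of `e_* Pʲ(E) ≅ Pʲ(e_* E)` with the projections `Pʲ → E ⊗ Ωʲ`. [cite: BuchweitzFlenner2003, §3 (Atiyah class) and §4 (the algebra A = ⊕ Ext^i(E, E ⊗ Ωʲ), At^k; reading: naturality under an isomorphism of the ambient scheme)] -/
theorem map_twistJetπ_comp_twistHodgePushforwardIso_hom :
    (pushforward e.hom.left).map (twistJetπ E j) ≫ (twistHodgePushforwardIso e E j).hom =
      (twistJetPushforwardIso e E j).hom ≫ twistJetπ ((pushforward e.hom.left).obj E) j :=
  Scheme.Modules.hom_ext _ _ fun U => AddCommGrpCat.ext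
    fun (_ : TwistJetSections E j (e.hom.left ⁻¹ᵁ U)) => rfl

end TwistJetIso

/-! ### The Atiyah steps along `e_*` -/

section AtiyahTransport

/-- `(P · i⁻¹) · (i · T) = P · T` in `Ext`. [folklore] -/
private theorem Ext.comp_mk₀_inv_comp_mk₀_hom_comp {C : Type*} [Category C] [Abelian C] [HasExt.{w} C]
    {A B B' D : C} {n m k : ℕ} (P : Ext A B' n) (i : B ≅ B') (T : Ext B' D m) (h : n + m = k) :
    (P.comp (Ext.mk₀ i.inv) (add_zero n)).comp ((Ext.mk₀ i.hom).comp T (zero_add m)) h = P.comp T h := by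
  rw [Ext.comp_assoc_of_second_deg_zero, Ext.mk₀_comp_mk₀_assoc, Iso.inv_hom_id, Ext.mk₀_id_comp]

variable (E : X₀.left.Modules) (j : ℕ)

/-- The morphism of twisted Atiyah sequences `e_*(0 → E⊗Ωʲ⁺¹ → Pʲ(E) → E⊗Ωʲ → 0) ⟶ (same for e_*E)`.
[folklore] -/
def twistJetShortComplexPushforwardHom :
    (twistJetShortComplex E j).map (pushforward e.hom.left) ⟶
      twistJetShortComplex ((pushforward e.hom.left).obj E) j where
  τ₁ := (twistHodgePushforwardIso e E (j + 1)).hom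
  τ₂ := (twistJetPushforwardIso e E j).hom
  τ₃ := (twistHodgePushforwardIso e E j).hom
  comm₁₂ := (map_twistJetι_comp_twistJetPushforwardIso_hom e E j).symm
  comm₂₃ := (map_twistJetπ_comp_twistHodgePushforwardIso_hom e E j).symm

variable [HasExt.{w} X₀.left.Modules] [HasExt.{w} X₁.left.Modules]

/-- **The Atiyah steps along `e_*`**: `e_*(at_j(E)) = α_j · at_j(e_*E) · α_{j+1}⁻¹` (naturality of the
Yoneda class of the twisted Atiyah sequence: Mathlib's `extClass_naturality` and `mapExactFunctor_extClass`).
[cite: BuchweitzFlenner2003, §3 (Atiyah class) and §4 (the algebra A = ⊕ Ext^i(E, E ⊗ Ωʲ), At^k; reading: naturality under an isomorphism of the ambient scheme)] -/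
theorem mapExactFunctor_atiyahClassStep :
    (atiyahClassStep E j).mapExactFunctor (pushforward e.hom.left) =
      (Ext.mk₀ (twistHodgePushforwardIso e E j).hom).comp
        ((atiyahClassStep ((pushforward e.hom.left).obj E) j).comp
          (Ext.mk₀ (twistHodgePushforwardIso e E (j + 1)).inv) (add_zero 1)) (zero_add 1) := by
  have h1 := Ext.mapExactFunctor_extClass (pushforward e.hom.left) (twistJetShortComplex_shortExact E j)
  have h2 := ((twistJetShortComplex_shortExact E j).map_of_exact (pushforward e.hom.left)).extClass_naturality
    (twistJetShortComplex_shortExact ((pushforward e.hom.left).obj E) j)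
    (twistJetShortComplexPushforwardHom e E j)
  have h4 := congrArg (fun z => z.comp (Ext.mk₀ (twistHodgePushforwardIso e E (j + 1)).inv) (add_zero 1)) h2
  simp only [Ext.comp_assoc_of_third_deg_zero, Ext.mk₀_comp_mk₀] at h4
  rw [show (twistJetShortComplexPushforwardHom e E j).τ₁ ≫ (twistHodgePushforwardIso e E (j + 1)).inv = 𝟙 _
      from (twistHodgePushforwardIso e E (j + 1)).hom_inv_id, Ext.comp_mk₀_id] at h4
  exact h1.trans h4

/-- **The Yoneda powers of the Atiyah class along `e_*`**: `e_*(At(E)^q) = α_0 · At(e_*E)^q · α_q⁻¹`.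
[cite: BuchweitzFlenner2003, §3 (Atiyah class) and §4 (the algebra A = ⊕ Ext^i(E, E ⊗ Ωʲ), At^k; reading: naturality under an isomorphism of the ambient scheme)] -/
theorem mapExactFunctor_atiyahClassPower (q : ℕ) :
    (atiyahClassPower E q).mapExactFunctor (pushforward e.hom.left) =
      (Ext.mk₀ (twistHodgePushforwardIso e E 0).hom).comp
        ((atiyahClassPower ((pushforward e.hom.left).obj E) q).comp
          (Ext.mk₀ (twistHodgePushforwardIso e E q).inv) (add_zero q)) (zero_add q) := by
  induction q with
  | zero =>
    rw [atiyahClassPower_zero, atiyahClassPower_zero, Ext.mapExactFunctor_mk₀, CategoryTheory.Functor.map_id,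
      Ext.mk₀_id_comp, Ext.mk₀_comp_mk₀, Iso.hom_inv_id]
  | succ q ih =>
    rw [atiyahClassPower_succ, atiyahClassPower_succ, Ext.mapExactFunctor_comp, ih,
      mapExactFunctor_atiyahClassStep,
      Ext.comp_assoc (Ext.mk₀ (twistHodgePushforwardIso e E 0).hom) _ _ (zero_add q) rfl (by omega),
      Ext.comp_mk₀_inv_comp_mk₀_hom_comp, ← Ext.comp_assoc_of_third_deg_zero]

end AtiyahTransport

/-! ### `ι : E → E ⊗ Ω⁰` along `e_*` -/

section Iota

variable (E : X₀.left.Modules)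

/-- **Pull-back of `0`-forms is `e♯` on functions**: `(𝒪 ≅ Ω⁰)⁻¹ ≫ e^♯ = e♯ ≫ e_*((𝒪 ≅ Ω⁰)⁻¹)` as morphisms
`𝒪_{X₁} ⟶ e_* Ω⁰_{X₀}`. [cite: Hartshorne1977, II Prop. 8.11 (the pull-back of differentials f^*Ω_{Y/S} → Ω_{X/S}; reading: on 0-forms it is f♯)] -/
theorem hodgeSheafZeroIso_inv_comp_comap :
    (hodgeSheafZeroIso X₁).inv ≫ hodgeSheaf.comap e.hom 0 =
      (unitPushforwardIso (leftIso' e)).hom ≫ (pushforward e.hom.left).map (hodgeSheafZeroIso X₀).inv := by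
  refine Scheme.Modules.hom_ext _ _ fun U => AddCommGrpCat.ext fun (a : Γ(X₁.left, U)) => ?_
  change (hodgeSheaf.comap e.hom 0).app U ((hodgeSheafZeroIso X₁).inv.app U a) =
    (hodgeSheafZeroIso X₀).inv.app (e.hom.left ⁻¹ᵁ U) (e.hom.left.app U a)
  rw [hodgeSheafZeroIso_inv_app, hodgeSheafZeroIso_inv_app]
  erw [exteriorPower_iso₀_inv_apply, exteriorPower_iso₀_inv_apply, hodgeSheaf.comap_app_toHodgeSheaf,
    comapWedge_smul, comapWedge_mk]
  congr 2

/-- Sections form of `hodgeSheafZeroIso_inv_comp_comap`, read backwards along `e♯`. [cite: Hartshorne1977, II Prop. 8.11 (the pull-back of differentials f^*Ω_{Y/S} → Ω_{X/S}; reading: on 0-forms it is f♯)] -/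
theorem comap_app_hodgeSheafZeroIso_inv_app_inv (W : X₁.left.Opens) (r : Γ(X₀.left, e.hom.left ⁻¹ᵁ W)) :
    (hodgeSheaf.comap e.hom 0).app W ((hodgeSheafZeroIso X₁).inv.app W
        ((unitPushforwardIso (leftIso' e)).inv.app W r)) =
      (hodgeSheafZeroIso X₀).inv.app (e.hom.left ⁻¹ᵁ W) r := by
  have h := congrArg (fun φ => Scheme.Modules.Hom.app φ W ((unitPushforwardIso (leftIso' e)).inv.app W r))
    (hodgeSheafZeroIso_inv_comp_comap e)
  simp only [Scheme.Modules.Hom.comp_app, ConcreteCategory.comp_apply] at h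
  rw [h]
  change ((pushforward e.hom.left).map (hodgeSheafZeroIso X₀).inv).app W
    (((unitPushforwardIso (leftIso' e)).inv ≫ (unitPushforwardIso (leftIso' e)).hom).app W r) = _
  rw [Iso.inv_hom_id]
  rfl

/-- **`ι : E → E ⊗ Ω⁰` along `e_*`** (first form): `e_*(ι_E)` followed by the comparison
`e_*𝓗om(E^∨, Ω⁰) ≅ 𝓗om(e_*E^∨, e_*Ω⁰)` is `ι_{e_*E}` followed by `𝓗om((e_*E)^∨, e^♯)` and
`𝓗om(e_*E^∨ ≅ (e_*E)^∨, –)`. [cite: Hartshorne1977, II Ex. 5.1 (a), (b) (E → E^∨∨, 𝓗om(E^∨, G) ≅ E ⊗ G; reading: bookkeeping along an isomorphism of schemes)] -/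
theorem map_toTwistHodgeZero_comp_comparison :
    (pushforward e.hom.left).map (toTwistHodgeZero E) ≫
        (sheafHomPushforwardIso (leftIso' e) (dual E) (hodgeSheaf X₀ 0)).hom =
      toTwistHodgeZero ((pushforward e.hom.left).obj E) ≫
        sheafHomMap _ (hodgeSheaf.comapIso e 0).hom ≫
          sheafHomMapLeft (dualPushforwardIso (leftIso' e) E).hom _ := by
  refine Scheme.Modules.hom_ext _ _ fun U => AddCommGrpCat.ext fun (s : Γ(E, e.hom.left ⁻¹ᵁ U)) => ?_
  change pushforwardOverHom e.hom.left _ _ ((toTwistHodgeZero E).app (e.hom.left ⁻¹ᵁ U) s) =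
    (sheafHomMapLeft (dualPushforwardIso (leftIso' e) E).hom _).app U
      ((sheafHomMap _ (hodgeSheaf.comapIso e 0).hom).app U
        ((toTwistHodgeZero ((pushforward e.hom.left).obj E)).app U s))
  rw [sheafHomMapLeft_app_apply, sheafHomMap_app_apply, toTwistHodgeZero_app_apply,
    toTwistHodgeZero_app_apply]
  refine hom_ext_of_appLE fun W k (μ : E.over (e.hom.left ⁻¹ᵁ W) ⟶ (unitModule X₀.left).over _) => ?_
  rw [appLE_pushforwardOverHom, appLE_comp_over_map, appLE_evalAt, appLE_over_map_comp,
    appLE_comp_over_map, appLE_comp_over_map, appLE_evalAt]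
  -- the section `(e_*E^∨ ≅ (e_*E)^∨)(μ) = pushforwardOverHom μ ≫ (e♯)⁻¹|`
  have hμ : (dualPushforwardIso (leftIso' e) E).hom.app W μ =
      pushforwardOverHom e.hom.left _ _ μ ≫
        (SheafOfModules.overFunctor _ W).map (unitPushforwardIso (leftIso' e)).inv := rfl
  rw [hμ, appLE_comp_over_map, appLE_pushforwardOverHom, hodgeSheaf.comapIso_hom,
    comap_app_hodgeSheafZeroIso_inv_app_inv,
    appLE_congr_hom μ ((Opens.map e.hom.left.base).map (𝟙 W)) (𝟙 _)]
  rfl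

/-- **`ι : E → E ⊗ Ω⁰` along `e_*`**: `e_*(ι_E) ≫ α_0 = ι_{e_*E}`. [cite: Hartshorne1977, II Ex. 5.1 (a), (b) (E → E^∨∨, 𝓗om(E^∨, G) ≅ E ⊗ G; reading: bookkeeping along an isomorphism of schemes)] -/
theorem map_toTwistHodgeZero_comp :
    (pushforward e.hom.left).map (toTwistHodgeZero E) ≫ (twistHodgePushforwardIso e E 0).hom =
      toTwistHodgeZero ((pushforward e.hom.left).obj E) := by
  have h := map_toTwistHodgeZero_comp_comparison e E
  change (pushforward e.hom.left).map (toTwistHodgeZero E) ≫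
    ((sheafHomPushforwardIso (leftIso' e) (dual E) (hodgeSheaf X₀ 0)).hom ≫
      sheafHomMapLeft (dualPushforwardIso (leftIso' e) E).inv _) ≫
        sheafHomMap _ (hodgeSheaf.comapIso e 0).inv = _
  rw [← Category.assoc, ← Category.assoc, h, Category.assoc, Category.assoc, Category.assoc,
    ← Category.assoc (sheafHomMapLeft _ _) (sheafHomMapLeft _ _), ← sheafHomMapLeft_comp, Iso.inv_hom_id,
    sheafHomMapLeft_id, Category.id_comp, ← sheafHomMap_comp, Iso.hom_inv_id, sheafHomMap_id,
    Category.comp_id]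

end Iota

end Literature.AlgebraicGeometry.HodgeTheory

end
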